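import Mathlib
import Summits.ResolutionOfSingularities.ResolutionOfSingularities.Theorems.WeightedInvariantLocalWeightedDropWildMonicWCleanGermSupp
import Summits.ResolutionOfSingularities.ResolutionOfSingularities.Theorems.WeightedInvariantLocalWeightedDropWildMonicWCleanProcess

/-!
# `WeightedInvariant.LocalWeightedDrop`, line `hasse-ridge-face-selection`, S3ρ sub-stub S3ρD `stub_wildMonicSurfaceDescent`:
# `w`-CLEANING WITH INVARIANTS — Perlega Prop. 5.1.5 together with Lemma 5.1.8 (other cleanness kept) and Lemma 5.2.2 (1) (`s` kept)

Crux item stmt-ResolutionOfSingularities-8899 `LocalWeightedDrop` (route `ResolutionOfSingularities/WeightedInvariant`), engine of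
the door `HypersurfaceCentreConstruction` stmt-ResolutionOfSingularities-19897.  [OURS · L1 W4.3, chain w43, res-L1-w43-stub-7 (second
seat on S3ρ under res-type-083); pipeline step «W-clean / W-re-clean» of Uk-ρD1 (STATUS 2026-08-27 09:2xZ).  MODEL: S. Perlega,
thesis Wien 2017 / arXiv:2011.14443, Ch. 5 §1.2 (the `w`-cleaning process, Prop. 5.1.5), Lemma 5.1.8 (w_cleaning_preserves_v_cleaning:
«a `ν`-cleaning step preserves `w`-cleanness» — because the germ `g = −C(c,q)^{-1}G`, `G^q = in_ν(f_{c−q})`, satisfies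
`w(g) ≥ (1/q)·w(f_{c−q})` for EVERY `w`), and Ch. 9 p0105: «we may assume `f` clean with respect to finitely many weighted order
functions».  Nothing here is a statement of H. Hironaka's manuscript [claim: Hironaka2017, status: under-review]; OUR objects.]

* (the germ with its support clause and its consequences `slotWOrd_le_of_supp` / `theta_le_of_supp` are in
  `…WildMonicWCleanGermSupp`);
* the process `cleanSeqS` (as `cleanSeq` of p505741, germ with support clause) and its invariants `cleanSeqS_preserve` (Lemma 5.1.8:
  every `w`-cleanness of the start with finite `m_w` is kept, with the same `m_w`), `wMin_le_cleanSeqS_all` (no `m_w` decreases),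
  `cleanSeqS_setting` (at a `(1,1)`/`(1,0)`/`(0,1)`-clean start: `(δ, r)` kept and `s` does not drop, Lemma 5.2.2 (1));
* `exists_shift_isWClean_keep` — PROP. 5.1.5 WITH INVARIANTS: a re-centring to a `ν`-clean tuple keeping all of the above, or to the
  zero tuple.
-/

set_option linter.dupNamespace false -- mandated namespace of this single-conjunct summit

noncomputable section

namespace Summit.ResolutionOfSingularities.ResolutionOfSingularities.Theorems

namespace WildMonic

open MvPowerSeries MonicDescent

variable {k : Type} [Field k] (p : ℕ) [Fact p.Prime] [CharP k p] (w : Fin 2 → ℕ) {d : ℕ}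
  (A : Fin d → MvPowerSeries (Fin 2) k)

/-! ## The process with the support clause -/

section Process

variable [PerfectRing k p]

/-- One stage of the cleaning process, germ with support clause (as `cleanStage`, p505741). -/
def cleanStageS (hd : 0 < d) (BG : (Fin d → MvPowerSeries (Fin 2) k) × MvPowerSeries (Fin 2) k) :
    (Fin d → MvPowerSeries (Fin 2) k) × MvPowerSeries (Fin 2) k := by
  classical
  exact if h : ¬ IsWClean p w BG.1 ∧ wMin w BG.1 ≠ ⊤ ∧ constantCoeff (BG.1 (qSlot p d hd)) = 0 then
    (shift d BG.1 (Classical.choose (exists_cleaning_germ_supp p w BG.1 hd h.2.1 h.2.2 h.1)),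
      Classical.choose (exists_cleaning_germ_supp p w BG.1 hd h.2.1 h.2.2 h.1) + BG.2)
  else BG

/-- The cleaning process with support clause: stage `n` (tuple and accumulated re-centring). -/
def cleanSeqS (hd : 0 < d) (A : Fin d → MvPowerSeries (Fin 2) k) : ℕ → (Fin d → MvPowerSeries (Fin 2) k) × MvPowerSeries (Fin 2) k
  | 0 => (A, 0)
  | n + 1 => cleanStageS p w hd (cleanSeqS hd A n)

variable (hd : 0 < d) (hA : ∀ j, constantCoeff (A j) = 0)

/-- The process runs at stage `n`. -/
def RunsS (n : ℕ) : Prop := ¬ IsWClean p w (cleanSeqS p w hd A n).1 ∧ wMin w (cleanSeqS p w hd A n).1 ≠ ⊤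

/-- Stage `n` is `shift d A G_n` with `G_n(0) = 0`. -/
theorem cleanSeqS_spec (n : ℕ) :
    (cleanSeqS p w hd A n).1 = shift d A (cleanSeqS p w hd A n).2 ∧ constantCoeff (cleanSeqS p w hd A n).2 = 0 := by
  induction n with
  | zero => exact ⟨(shift_zero d A).symm, map_zero _⟩
  | succ n ih =>
    show (cleanStageS p w hd (cleanSeqS p w hd A n)).1 = shift d A (cleanStageS p w hd (cleanSeqS p w hd A n)).2 ∧
      constantCoeff (cleanStageS p w hd (cleanSeqS p w hd A n)).2 = 0
    unfold cleanStageS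
    split_ifs with h
    · refine ⟨?_, ?_⟩
      · change shift d (cleanSeqS p w hd A n).1 _ = shift d A (_ + (cleanSeqS p w hd A n).2)
        rw [← shift_shift, ← ih.1]
      · change constantCoeff (_ + (cleanSeqS p w hd A n).2) = 0
        rw [map_add, (Classical.choose_spec (exists_cleaning_germ_supp p w _ hd h.2.1 h.2.2 h.1)).1, ih.2, add_zero]
    · exact ih

include hA in
/-- Constant coefficients stay `0`. -/
theorem constantCoeff_cleanSeqS (n : ℕ) (j : Fin d) : constantCoeff ((cleanSeqS p w hd A n).1 j) = 0 := by
  rw [(cleanSeqS_spec p w A hd n).1]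
  exact constantCoeff_shift A hA (cleanSeqS_spec p w A hd n).2 j

include hA in
/-- ONE STEP, with the support clause of the germ. -/
theorem cleanSeqS_step {n : ℕ} (hr : RunsS p w A hd n) :
    ∃ g : MvPowerSeries (Fin 2) k, (cleanSeqS p w hd A (n + 1)).2 = g + (cleanSeqS p w hd A n).2 ∧
      (cleanSeqS p w hd A (n + 1)).1 = shift d (cleanSeqS p w hd A n).1 g ∧
      (d.factorial : ℕ∞) * g.weightedOrder w = wMin w (cleanSeqS p w hd A n).1 ∧
      wMin w (cleanSeqS p w hd A n).1 ≤ wMin w (cleanSeqS p w hd A (n + 1)).1 ∧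
      (wMin w (cleanSeqS p w hd A n).1 < wMin w (cleanSeqS p w hd A (n + 1)).1 ∨ IsWClean p w (cleanSeqS p w hd A (n + 1)).1) ∧
      ∀ α : Fin 2 →₀ ℕ, coeff α g ≠ 0 → coeff (qOf p d • α) ((cleanSeqS p w hd A n).1 (qSlot p d hd)) ≠ 0 := by
  have h : ¬ IsWClean p w (cleanSeqS p w hd A n).1 ∧ wMin w (cleanSeqS p w hd A n).1 ≠ ⊤ ∧
      constantCoeff ((cleanSeqS p w hd A n).1 (qSlot p d hd)) = 0 := ⟨hr.1, hr.2, constantCoeff_cleanSeqS p w A hd hA n _⟩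
  have hstage : cleanSeqS p w hd A (n + 1) = cleanStageS p w hd (cleanSeqS p w hd A n) := rfl
  set g := Classical.choose (exists_cleaning_germ_supp p w (cleanSeqS p w hd A n).1 hd h.2.1 h.2.2 h.1) with hgdef
  have hg := Classical.choose_spec (exists_cleaning_germ_supp p w (cleanSeqS p w hd A n).1 hd h.2.1 h.2.2 h.1)
  have h1 : (cleanSeqS p w hd A (n + 1)).1 = shift d (cleanSeqS p w hd A n).1 g := by
    rw [hstage]; unfold cleanStageS; rw [dif_pos h]
  have h2 : (cleanSeqS p w hd A (n + 1)).2 = g + (cleanSeqS p w hd A n).2 := by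
    rw [hstage]; unfold cleanStageS; rw [dif_pos h]
  obtain ⟨hle, hor⟩ := cleaningStep_spec p w (cleanSeqS p w hd A n).1 hd h.2.1 h.1 hg.2.1 hg.2.2.1
  refine ⟨g, h2, h1, hg.2.1, by rw [h1]; exact hle, ?_, hg.2.2.2⟩
  rw [h1]
  rcases hor with hlt | ⟨-, hcl⟩
  · exact Or.inl hlt
  · exact Or.inr hcl

/-- If the process does not run at stage `n`, it is stationary. -/
theorem cleanSeqS_succ_of_not_runs {n : ℕ} (hr : ¬ RunsS p w A hd n) : cleanSeqS p w hd A (n + 1) = cleanSeqS p w hd A n := by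
  show cleanStageS p w hd (cleanSeqS p w hd A n) = cleanSeqS p w hd A n
  unfold cleanStageS
  rw [dif_neg]
  exact fun h => hr ⟨h.1, h.2.1⟩

include hA in
/-- While the process runs through stage `n`, `m_n ≥ m_0 + n`. -/
theorem le_wMin_cleanSeqS (n : ℕ) (hrun : ∀ i ≤ n, RunsS p w A hd i) : wMin w A + n ≤ wMin w (cleanSeqS p w hd A n).1 := by
  induction n with
  | zero => simp [cleanSeqS]
  | succ n ih =>
    have hn : RunsS p w A hd n := hrun n (Nat.le_succ n)
    obtain ⟨g, -, -, -, -, hor, -⟩ := cleanSeqS_step p w A hd hA hn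
    have ih' := ih fun i hi => hrun i (Nat.le_succ_of_le hi)
    rcases hor with hlt | hcl
    · calc wMin w A + ((n + 1 : ℕ) : ℕ∞) = (wMin w A + n) + 1 := by push_cast; ring
        _ ≤ wMin w (cleanSeqS p w hd A n).1 + 1 := by gcongr
        _ ≤ _ := Order.add_one_le_of_lt hlt
    · exact absurd hcl (hrun (n + 1) le_rfl).1

include hA in
/-- NO `m_{w′}` DECREASES along the process, for ANY weight `w′` (Lemma 5.1.7 (1) via the support clause). -/
theorem wMin_le_cleanSeqS_all (w' : Fin 2 → ℕ) (n : ℕ) : wMin w' A ≤ wMin w' (cleanSeqS p w hd A n).1 := by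
  induction n with
  | zero => simp [cleanSeqS]
  | succ n ih =>
    by_cases hr : RunsS p w A hd n
    · obtain ⟨g, -, h1, -, -, -, hsupp⟩ := cleanSeqS_step p w A hd hA hr
      rw [h1]
      refine ih.trans (wMin_le_wMin_shift w' _ g ?_)
      exact (wMin_le_slotWOrd w' _ _).trans (slotWOrd_le_of_supp p _ hd hsupp w')
    · rw [cleanSeqS_succ_of_not_runs p w A hd hr]; exact ih

include hA in
/-- The accumulated re-centring has `d!·ord_w(G_n) ≥ m_0`. -/
theorem le_weightedOrder_cleanSeqS_snd (n : ℕ) :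
    wMin w A ≤ (d.factorial : ℕ∞) * ((cleanSeqS p w hd A n).2).weightedOrder w := by
  induction n with
  | zero =>
    simp only [cleanSeqS, weightedOrder_zero]
    rw [ENat.mul_top (by exact_mod_cast (Nat.factorial_pos d).ne')]; exact le_top
  | succ n ih =>
    by_cases hr : RunsS p w A hd n
    · obtain ⟨g, h2, -, hgm, -, -, -⟩ := cleanSeqS_step p w A hd hA hr
      rw [h2]
      exact le_mul_weightedOrder_add w (by rw [hgm]; exact wMin_le_cleanSeqS_all p w A hd hA w n) ih
    · rw [cleanSeqS_succ_of_not_runs p w A hd hr]; exact ih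

include hA in
/-- `m` is monotone along the process. -/
theorem wMin_cleanSeqS_mono {n i : ℕ} (hni : n ≤ i) : wMin w (cleanSeqS p w hd A n).1 ≤ wMin w (cleanSeqS p w hd A i).1 := by
  induction i, hni using Nat.le_induction with
  | base => exact le_rfl
  | succ i _ ih =>
    refine ih.trans ?_
    by_cases hr : RunsS p w A hd i
    · obtain ⟨g, -, -, -, hle, -, -⟩ := cleanSeqS_step p w A hd hA hr; exact hle
    · rw [cleanSeqS_succ_of_not_runs p w A hd hr]

include hA in
/-- Coefficients below the current level are frozen. -/
theorem coeff_cleanSeqS_snd_eq_of_le {n i : ℕ} (hni : n ≤ i) {e : Fin 2 →₀ ℕ}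
    (he : ((d.factorial * Finsupp.weight w e : ℕ) : ℕ∞) < wMin w (cleanSeqS p w hd A n).1) :
    coeff e (cleanSeqS p w hd A i).2 = coeff e (cleanSeqS p w hd A n).2 := by
  induction i, hni using Nat.le_induction with
  | base => rfl
  | succ i hni ih =>
    by_cases hr : RunsS p w A hd i
    · obtain ⟨g, h2, -, hgm, -, -, -⟩ := cleanSeqS_step p w A hd hA hr
      have h := lt_of_lt_of_le he ((wMin_cleanSeqS_mono p w A hd hA hni).trans (le_of_eq hgm.symm))
      push_cast at h
      rw [h2, map_add, ih, coeff_eq_zero_of_lt_weightedOrder w (lt_of_mul_lt_mul_left h bot_le), zero_add]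
    · rw [cleanSeqS_succ_of_not_runs p w A hd hr]; exact ih

include hA in
/-- LEMMA 5.1.8 ALONG THE PROCESS: every `w′`-cleanness of the start with finite `m_{w′}` is kept, with the same `m_{w′}`. -/
theorem cleanSeqS_preserve (w' : Fin 2 → ℕ) (hw' : IsWClean p w' A) (hfin : wMin w' A ≠ ⊤) (n : ℕ) :
    IsWClean p w' (cleanSeqS p w hd A n).1 ∧ wMin w' (cleanSeqS p w hd A n).1 = wMin w' A := by
  induction n with
  | zero => exact ⟨hw', rfl⟩
  | succ n ih =>
    by_cases hr : RunsS p w A hd n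
    · obtain ⟨g, -, h1, -, -, -, hsupp⟩ := cleanSeqS_step p w A hd hA hr
      have hfinn : wMin w' (cleanSeqS p w hd A n).1 ≠ ⊤ := by rw [ih.2]; exact hfin
      have ha := slotWOrd_le_of_supp p _ hd hsupp w'
      rw [h1]
      exact ⟨isWClean_shift_of_isWClean p w' _ g ih.1 hfinn (qSlot_val p hd) (Or.inl ha),
        (wMin_shift_eq_of_isWClean p w' _ g ih.1 hfinn ((wMin_le_slotWOrd w' _ _).trans ha)).trans ih.2⟩
    · rw [cleanSeqS_succ_of_not_runs p w A hd hr]; exact ih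

include hA in
/-- LEMMAS 5.2.7 + 5.2.2 (1) ALONG THE PROCESS: at a start that is `(1,1)`-clean (finite `m`), `(1,0)`-clean if `0 ∈ E`, `(0,1)`-clean if
`1 ∈ E`, the setting `(δ, r)` is kept and `s` does not drop. -/
theorem cleanSeqS_setting (E : Finset (Fin 2)) {s : ℕ} (hfin : wMin ![1, 1] A ≠ ⊤) (h11 : IsWClean p ![1, 1] A)
    (h10 : (0 : Fin 2) ∈ E → IsWClean p ![1, 0] A) (h01 : (1 : Fin 2) ∈ E → IsWClean p ![0, 1] A)
    (hs : (s : ℕ∞) ≤ sFlag E (newtonSet A)) (n : ℕ) :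
    excExp E (newtonSet (cleanSeqS p w hd A n).1) = excExp E (newtonSet A) ∧
      dRes E (newtonSet (cleanSeqS p w hd A n).1) = dRes E (newtonSet A) ∧ (s : ℕ∞) ≤ sFlag E (newtonSet (cleanSeqS p w hd A n).1) := by
  have hne : ∀ w' : Fin 2 → ℕ, wMin w' A ≠ ⊤ := by
    intro w' htop
    apply hfin
    rw [eq_zero_of_wMin_eq_top w' A htop]
    unfold wMin slotWOrd
    simp only [Pi.zero_apply, weightedOrder_zero]
    rw [iInf_eq_top]
    intro i
    exact ENat.mul_top (by exact_mod_cast (slotWeight_pos i).ne')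
  induction n with
  | zero => exact ⟨rfl, rfl, hs⟩
  | succ n ih =>
    by_cases hr : RunsS p w A hd n
    · obtain ⟨g, -, h1, -, -, -, hsupp⟩ := cleanSeqS_step p w A hd hA hr
      obtain ⟨ihr, ihδ, ihs⟩ := ih
      have hpres : ∀ w' : Fin 2 → ℕ, IsWClean p w' A →
          wMin w' (shift d (cleanSeqS p w hd A n).1 g) = wMin w' (cleanSeqS p w hd A n).1 := by
        intro w' hw'
        obtain ⟨hcn, hmn⟩ := cleanSeqS_preserve p w A hd hA w' hw' (hne w') n
        exact wMin_shift_eq_of_isWClean p w' _ g hcn (by rw [hmn]; exact hne w')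
          ((wMin_le_slotWOrd w' _ _).trans (slotWOrd_le_of_supp p _ hd hsupp w'))
      have hr' : excExp E (newtonSet (shift d (cleanSeqS p w hd A n).1 g)) = excExp E (newtonSet (cleanSeqS p w hd A n).1) :=
        excExp_eq_of_wMin_eq E (fun h => hpres _ (h10 h)) (fun h => hpres _ (h01 h))
      have hδ' : dRes E (newtonSet (shift d (cleanSeqS p w hd A n).1 g)) = dRes E (newtonSet (cleanSeqS p w hd A n).1) :=
        dRes_eq_of_wMin_eq E (fun h => hpres _ (h10 h)) (fun h => hpres _ (h01 h)) (hpres _ h11)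
      rw [h1]
      refine ⟨hr'.trans ihr, hδ'.trans ihδ, ?_⟩
      exact natCast_le_sFlag_shift E E _ g ihs hδ' hr' (theta_le_of_supp p _ hd hsupp E ihs)
    · rw [cleanSeqS_succ_of_not_runs p w A hd hr]; exact ih

include hd hA in
/-- PERLEGA PROP. 5.1.5 WITH INVARIANTS (Lemmas 5.1.8, 5.2.7, 5.2.2 (1)): over a perfect field, every position `A` (`A_j(0) = 0`) can be
re-centred (`g(0) = 0`, `d!·ord_w g ≥ m_w(A)`, no `m_{w′}` decreased) EITHER to a `w`-CLEAN tuple such that every `w′`-cleanness of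
`A` with finite `m_{w′}` is kept with the same `m_{w′}` and, at a `(1,1)`/`(1,0)`/`(0,1)`-clean start, `(δ, r)` is kept and `s` does
not drop — OR to the ZERO tuple. -/
theorem exists_shift_isWClean_keep :
    ∃ g : MvPowerSeries (Fin 2) k, constantCoeff g = 0 ∧ wMin w A ≤ (d.factorial : ℕ∞) * g.weightedOrder w ∧
      (∀ w' : Fin 2 → ℕ, wMin w' A ≤ wMin w' (shift d A g)) ∧
      ((IsWClean p w (shift d A g) ∧
        (∀ w' : Fin 2 → ℕ, IsWClean p w' A → wMin w' A ≠ ⊤ → IsWClean p w' (shift d A g) ∧ wMin w' (shift d A g) = wMin w' A) ∧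
        (∀ (E : Finset (Fin 2)) (s : ℕ), wMin ![1, 1] A ≠ ⊤ → IsWClean p ![1, 1] A →
          ((0 : Fin 2) ∈ E → IsWClean p ![1, 0] A) → ((1 : Fin 2) ∈ E → IsWClean p ![0, 1] A) →
          (s : ℕ∞) ≤ sFlag E (newtonSet A) →
          excExp E (newtonSet (shift d A g)) = excExp E (newtonSet A) ∧ dRes E (newtonSet (shift d A g)) = dRes E (newtonSet A) ∧
            (s : ℕ∞) ≤ sFlag E (newtonSet (shift d A g)))) ∨
        shift d A g = 0) := by
  have hmono0 : ∀ (g : MvPowerSeries (Fin 2) k) (w' : Fin 2 → ℕ), shift d A g = 0 → wMin w' A ≤ wMin w' (shift d A g) := by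
    intro g w' h0
    rw [h0]
    refine le_trans le_top (le_of_eq ?_)
    symm
    unfold wMin slotWOrd
    simp only [Pi.zero_apply, weightedOrder_zero]
    rw [iInf_eq_top]
    intro i
    exact ENat.mul_top (by exact_mod_cast (slotWeight_pos i).ne')
  by_cases hstop : ∃ n, ¬ RunsS p w A hd n
  · -- the process terminates
    obtain ⟨n, hn⟩ := hstop
    have hspec := cleanSeqS_spec p w A hd n
    refine ⟨(cleanSeqS p w hd A n).2, hspec.2, le_weightedOrder_cleanSeqS_snd p w A hd hA n, ?_, ?_⟩
    · intro w'; rw [← hspec.1]; exact wMin_le_cleanSeqS_all p w A hd hA w' n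
    rw [← hspec.1]
    unfold RunsS at hn
    by_cases hcl : IsWClean p w (cleanSeqS p w hd A n).1
    · left
      refine ⟨hcl, fun w' hw' hfin => cleanSeqS_preserve p w A hd hA w' hw' hfin n, fun E s hfin h11 h10 h01 hs => ?_⟩
      exact cleanSeqS_setting p w A hd hA E hfin h11 h10 h01 hs n
    · right
      exact eq_zero_of_wMin_eq_top w _ (by by_contra ht; exact hn ⟨hcl, ht⟩)
  · -- the process runs forever: coefficientwise limit, the tuple dies
    push Not at hstop
    have hclimb : ∀ n : ℕ, wMin w A + n ≤ wMin w (cleanSeqS p w hd A n).1 := fun n =>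
      le_wMin_cleanSeqS p w A hd hA n fun i _ => hstop i
    let N : (Fin 2 →₀ ℕ) → ℕ := fun e => d.factorial * Finsupp.weight w e + 1
    have hN : ∀ e n, N e ≤ n → ((d.factorial * Finsupp.weight w e : ℕ) : ℕ∞) < wMin w (cleanSeqS p w hd A n).1 := by
      intro e n hn
      refine lt_of_lt_of_le ?_ (hclimb n)
      calc ((d.factorial * Finsupp.weight w e : ℕ) : ℕ∞) < ((N e : ℕ) : ℕ∞) := by exact_mod_cast Nat.lt_succ_self _
        _ ≤ (n : ℕ∞) := by exact_mod_cast hn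
        _ ≤ wMin w A + n := le_add_self
    let G : MvPowerSeries (Fin 2) k := fun e => coeff e (cleanSeqS p w hd A (N e)).2
    have hGcoeff : ∀ e n, N e ≤ n → coeff e G = coeff e (cleanSeqS p w hd A n).2 := fun e n hn =>
      (coeff_cleanSeqS_snd_eq_of_le p w A hd hA hn (hN e (N e) le_rfl)).symm
    have htail : ∀ n, wMin w (cleanSeqS p w hd A n).1 ≤ (d.factorial : ℕ∞) * (G - (cleanSeqS p w hd A n).2).weightedOrder w := by
      intro n
      by_cases htop : (G - (cleanSeqS p w hd A n).2).weightedOrder w = ⊤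
      · rw [htop, ENat.mul_top (by exact_mod_cast (Nat.factorial_pos d).ne')]; exact le_top
      obtain ⟨e, he, hwe⟩ := exists_coeff_ne_zero_and_weightedOrder w (f := G - (cleanSeqS p w hd A n).2)
        (ENat.coe_toNat htop)
      rw [← hwe]
      by_contra hlt
      rw [not_le] at hlt
      apply he
      have hmax : N e ≤ max n (N e) := le_max_right _ _
      rw [map_sub, hGcoeff e (max n (N e)) hmax, sub_eq_zero]
      refine coeff_cleanSeqS_snd_eq_of_le p w A hd hA (le_max_left _ _) ?_
      push_cast
      exact hlt
    have hzero : shift d A G = 0 := by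
      apply eq_zero_of_wMin_eq_top w
      refine ENat.eq_top_iff_forall_ge.mpr fun n => ?_
      have hsplit : shift d A G = shift d (cleanSeqS p w hd A n).1 (G - (cleanSeqS p w hd A n).2) := by
        rw [(cleanSeqS_spec p w A hd n).1, shift_shift, sub_add_cancel]
      calc (n : ℕ∞) ≤ wMin w A + n := le_add_self
        _ ≤ wMin w (cleanSeqS p w hd A n).1 := hclimb n
        _ ≤ wMin w (shift d A G) := by rw [hsplit]; exact wMin_le_wMin_shift w _ _ (htail n)
    refine ⟨G, ?_, ?_, fun w' => hmono0 G w' hzero, Or.inr hzero⟩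
    · show coeff 0 G = 0
      rw [hGcoeff 0 (N 0) le_rfl, coeff_zero_eq_constantCoeff]
      exact (cleanSeqS_spec p w A hd (N 0)).2
    · have h0 := htail 0
      simp only [cleanSeqS, sub_zero] at h0
      exact h0

end Process

end WildMonic

end Summit.ResolutionOfSingularities.ResolutionOfSingularities.Theorems

end
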